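import Mathlib
import Summits.MatrixMultiplication.MatrixMultiplication.Theses.GLnSeparatingDesigns
import Summits.MatrixMultiplication.MatrixMultiplication.Theorems.BorderHalfDimensionDesigns.Negative.CountingBarrier
import Summits.MatrixMultiplication.MatrixMultiplication.Theorems.BorderHalfDimensionDesigns.Negative.AffineSubfamilyBounds
import Summits.MatrixMultiplication.MatrixMultiplication.Theorems.GLnSeparatingDesignsSeparationDegreeCostStubMonomialCount

/-!
# Split designs, step (i): outer capacity times bi-semi-invariants `≤ dim ℂ[Mat_n]_{≤ 2s}`

Stub `stub_split_outer_times_invariants_le` of line `Ideate5Sketch` (crux `BorderHalfDimensionDesigns`,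
item stmt-MatrixMultiplication-18360, route `GLnSeparatingDesigns`), E2 = the split-design barrier.

If the targets `x z⁻¹` (`x ∈ X ⊆ H₁`, `z⁻¹ ∈ H₂` for `z ∈ Z`) are read `η`-approximately by polynomials
`r_{(x,z)}` of degree `≤ s` in the `n²` entries, with `η·|X||Z| < 1`, and `g₁, …, g_b` are linearly
independent polynomials of degree `≤ s` which, as functions on `GL_n(ℂ)`, are left-`(H₁,χ₁)`- and
right-`(H₂,χ₂)`-semi-invariant, then the `|X||Z|·b` products `r_{(x,z)} · g_j` are linearly independent
in `ℂ[Mat_n]_{≤ 2s}`, whence `|X|·|Z|·b ≤ C(2s + n², n²)`.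

Proof of independence.  A vanishing multiplier `χ₁ x = 0` (or `χ₂ z⁻¹ = 0`) would make every `g_j`
vanish on all of `GL_n(ℂ)`, hence as a polynomial (`MvPolynomial.eq_of_eval_eq_on_gl`), so all
multipliers at the points are nonzero.  Given `Σ c_{(x,z),j} r_{(x,z)} g_j = 0`, put
`E_{(x,z)} := Σ_j c_{(x,z),j} g_j` and evaluate at `x' w z'⁻¹` (`w ∈ GL_n`): semi-invariance pulls out the
nonzero scalar `χ₁(x') χ₂(z'⁻¹)`, leaving `Σ_{(x,z)} r_{(x,z)}(x' w z'⁻¹) · E_{(x,z)}(w) = 0`.  Substituting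
the linear forms "entries of `x' M z'⁻¹`" into `r_{(x,z)}` gives a polynomial matrix `F` with
`F *ᵥ E` vanishing on `GL_n`, hence `F *ᵥ E = 0`; `det F ≠ 0` because its value at `w = 1` is the
determinant of the `η`-approximate identity matrix `(r_{(x,z)}(x' z'⁻¹))`, strictly diagonally dominant
(`det_ne_zero_of_sum_row_lt_diag`, the engine of `BorderHalfDimensionDesignsNeg.card_le_finrank_of_approx_dual`).
Over the domain `ℂ[Mat_n]` this forces `E = 0`, and independence of the `g_j` gives `c = 0`.
The dimension count is `stub_finrank_restrictTotalDegree`.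
-/

set_option linter.dupNamespace false

open scoped BigOperators Matrix

namespace Summit.MatrixMultiplication.MatrixMultiplication.Theorems.BorderHalfDimensionDesigns

/-- **Strict diagonal dominance.** An `η`-approximate identity matrix (`‖A i i - 1‖ ≤ η`,
`‖A i j‖ ≤ η` off the diagonal) with `η · #ι < 1` is nonsingular. [folklore] -/
theorem splitOuter_det_ne_zero_of_approx_one {ι : Type*} [Fintype ι] [DecidableEq ι]
    (A : Matrix ι ι ℂ) (η : ℝ) (hη : η * Fintype.card ι < 1)
    (hdiag : ∀ i, ‖A i i - 1‖ ≤ η) (hoff : ∀ i j, i ≠ j → ‖A i j‖ ≤ η) : A.det ≠ 0 := by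
  -- adapted from the tree proof of `BorderHalfDimensionDesignsNeg.card_le_finrank_of_approx_dual`
  apply det_ne_zero_of_sum_row_lt_diag
  intro k
  set g : ι → ℝ := fun j => if j = k then ‖A k k - 1‖ else ‖A k j‖ with hg
  have hgle : ∀ j ∈ (Finset.univ : Finset ι), g j ≤ η := by
    intro j _
    by_cases hjk : j = k
    · subst hjk; simp only [g, if_true]; exact hdiag j
    · simp only [g, if_neg hjk]; exact hoff k j (Ne.symm hjk)
  have hsum : ∑ j, g j ≤ (Fintype.card ι : ℝ) * η := by
    have := Finset.sum_le_card_nsmul (Finset.univ : Finset ι) g η hgle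
    simpa [nsmul_eq_mul] using this
  have hsplit : ∑ j, g j = ‖A k k - 1‖ + ∑ j ∈ Finset.univ.erase k, ‖A k j‖ := by
    rw [← Finset.add_sum_erase _ _ (Finset.mem_univ k)]
    congr 1
    · simp [g]
    · refine Finset.sum_congr rfl fun j hj => ?_
      simp [g, Finset.ne_of_mem_erase hj]
  have htri : 1 - ‖A k k - 1‖ ≤ ‖A k k‖ := by
    have := norm_sub_norm_le (1 : ℂ) (1 - A k k)
    rw [norm_one, sub_sub_cancel, norm_sub_rev] at this
    linarith
  have hη' : (Fintype.card ι : ℝ) * η < 1 := by rwa [mul_comm] at hη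
  linarith

/-- **Readers times semi-invariants are independent.** Let `x_i, z_i ∈ GL_n(ℂ)` be points, `R_i`
polynomials whose value matrix `(R_i(x_{i'} z_{i'}⁻¹))_{i',i}` is nonsingular, and `g_j` linearly
independent polynomials with `g_j(x_{i'} w z_{i'}⁻¹) = χ_{i'} g_j(w)` on `GL_n(ℂ)` for nonzero scalars
`χ_{i'}`.  Then the products `R_i g_j` are linearly independent: from `Σ c_{ij} R_i g_j = 0`, evaluating at
`x_{i'} w z_{i'}⁻¹` shows that the polynomial vector `E_i := Σ_j c_{ij} g_j` is killed by the polynomial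
matrix `F_{i',i} := R_i(x_{i'} M z_{i'}⁻¹)` on `GL_n`, hence identically (`GL_n` is Zariski dense);
`det F ≠ 0` (its value at `M = 1` is the given nonsingular matrix), so `E = 0` and `c = 0`. [folklore] -/
theorem splitOuter_linearIndependent_mul {n b : ℕ} {ι : Type*} [Fintype ι] [DecidableEq ι]
    (x z : ι → Matrix.GeneralLinearGroup (Fin n) ℂ) (χ : ι → ℂ) (hχ : ∀ i, χ i ≠ 0)
    (R : ι → MvPolynomial (Fin n × Fin n) ℂ)
    (hR : (Matrix.of fun i' i : ι => MvPolynomial.eval (fun ij : Fin n × Fin n =>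
      ((x i' * (z i')⁻¹ : Matrix.GeneralLinearGroup (Fin n) ℂ) : Matrix (Fin n) (Fin n) ℂ) ij.1 ij.2)
        (R i)).det ≠ 0)
    (g : Fin b → MvPolynomial (Fin n × Fin n) ℂ) (hg : LinearIndependent ℂ g)
    (hginv : ∀ j i' (w : Matrix.GeneralLinearGroup (Fin n) ℂ),
      MvPolynomial.eval (fun ij : Fin n × Fin n =>
        ((x i' * w * (z i')⁻¹ : Matrix.GeneralLinearGroup (Fin n) ℂ) : Matrix (Fin n) (Fin n) ℂ) ij.1 ij.2)
          (g j) =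
      χ i' * MvPolynomial.eval (fun ij : Fin n × Fin n => (w : Matrix (Fin n) (Fin n) ℂ) ij.1 ij.2) (g j)) :
    LinearIndependent ℂ fun k : ι × Fin b => R k.1 * g k.2 := by
  classical
  rw [Fintype.linearIndependent_iff]
  intro c hc
  -- the would-be relations among the `g j`, one for each `i`
  obtain ⟨E, hE⟩ : ∃ E : ι → MvPolynomial (Fin n × Fin n) ℂ, E = fun i => ∑ j, c (i, j) • g j :=
    ⟨_, rfl⟩
  have hrel : ∑ i, R i * E i = 0 := by
    refine Eq.trans ?_ hc
    rw [Fintype.sum_prod_type]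
    exact Finset.sum_congr rfl fun i _ => by simp only [hE, Finset.mul_sum, mul_smul_comm]
  have hEinv : ∀ (i i' : ι) (w : Matrix.GeneralLinearGroup (Fin n) ℂ),
      MvPolynomial.eval (fun ij : Fin n × Fin n =>
        ((x i' * w * (z i')⁻¹ : Matrix.GeneralLinearGroup (Fin n) ℂ) : Matrix (Fin n) (Fin n) ℂ) ij.1 ij.2)
          (E i) =
      χ i' * MvPolynomial.eval (fun ij : Fin n × Fin n => (w : Matrix (Fin n) (Fin n) ℂ) ij.1 ij.2) (E i) := by
    intro i i' w
    simp only [hE, map_sum, MvPolynomial.smul_eval, Finset.mul_sum]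
    refine Finset.sum_congr rfl fun j _ => ?_
    rw [hginv j i' w]
    ring
  -- the linear forms "entries of `x i' · M · (z i')⁻¹`" in the entries of `M`
  obtain ⟨L, hL⟩ : ∃ L : ι → Fin n × Fin n → MvPolynomial (Fin n × Fin n) ℂ, L = fun i' ab =>
      ∑ l, (∑ k, MvPolynomial.C ((x i' : Matrix (Fin n) (Fin n) ℂ) ab.1 k) * MvPolynomial.X (k, l)) *
        MvPolynomial.C ((((z i')⁻¹ : Matrix.GeneralLinearGroup (Fin n) ℂ) : Matrix (Fin n) (Fin n) ℂ)
          l ab.2) :=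
    ⟨_, rfl⟩
  have hbind : ∀ (i' : ι) (w : Matrix.GeneralLinearGroup (Fin n) ℂ) (p : MvPolynomial (Fin n × Fin n) ℂ),
      MvPolynomial.eval (fun ij : Fin n × Fin n => (w : Matrix (Fin n) (Fin n) ℂ) ij.1 ij.2)
        (MvPolynomial.bind₁ (L i') p) =
      MvPolynomial.eval (fun ij : Fin n × Fin n =>
        ((x i' * w * (z i')⁻¹ : Matrix.GeneralLinearGroup (Fin n) ℂ) : Matrix (Fin n) (Fin n) ℂ) ij.1 ij.2)
          p := by
    intro i' w p
    have hfun : (fun ab : Fin n × Fin n => MvPolynomial.eval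
        (fun ij : Fin n × Fin n => (w : Matrix (Fin n) (Fin n) ℂ) ij.1 ij.2) (L i' ab)) =
        fun ij : Fin n × Fin n =>
          ((x i' * w * (z i')⁻¹ : Matrix.GeneralLinearGroup (Fin n) ℂ) : Matrix (Fin n) (Fin n) ℂ)
            ij.1 ij.2 := by
      funext ab
      simp only [hL, map_sum, map_mul, MvPolynomial.eval_C, MvPolynomial.eval_X, Units.val_mul,
        Matrix.mul_apply, Finset.sum_mul]
    calc MvPolynomial.eval (fun ij : Fin n × Fin n => (w : Matrix (Fin n) (Fin n) ℂ) ij.1 ij.2)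
          (MvPolynomial.bind₁ (L i') p)
        = MvPolynomial.eval (fun ab : Fin n × Fin n => MvPolynomial.eval
            (fun ij : Fin n × Fin n => (w : Matrix (Fin n) (Fin n) ℂ) ij.1 ij.2) (L i' ab)) p :=
          MvPolynomial.eval₂Hom_bind₁ _ _ _ _
      _ = _ := by rw [hfun]
  -- the polynomial matrix `F` and its nonvanishing determinant
  obtain ⟨F, hF⟩ : ∃ F : Matrix ι ι (MvPolynomial (Fin n × Fin n) ℂ),
      F = Matrix.of fun i' i => MvPolynomial.bind₁ (L i') (R i) := ⟨_, rfl⟩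
  have hdet : F.det ≠ 0 := by
    intro h0
    have h1 := congrArg (MvPolynomial.eval (fun ij : Fin n × Fin n =>
      ((1 : Matrix.GeneralLinearGroup (Fin n) ℂ) : Matrix (Fin n) (Fin n) ℂ) ij.1 ij.2)) h0
    rw [RingHom.map_det, map_zero] at h1
    refine hR (Eq.trans ?_ h1)
    congr 1
    ext i' i
    simp only [RingHom.mapMatrix_apply, Matrix.map_apply, hF, Matrix.of_apply, hbind, mul_one]
  -- `F *ᵥ E` vanishes on `GL_n`, hence identically
  have hmv : F *ᵥ E = 0 := by
    funext i'
    apply MvPolynomial.eq_of_eval_eq_on_gl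
    intro w
    rw [Pi.zero_apply, map_zero]
    have h2 := congrArg (MvPolynomial.eval (fun ij : Fin n × Fin n =>
      ((x i' * w * (z i')⁻¹ : Matrix.GeneralLinearGroup (Fin n) ℂ) : Matrix (Fin n) (Fin n) ℂ) ij.1 ij.2)) hrel
    rw [map_sum, map_zero] at h2
    simp only [map_mul, hEinv _ i' w] at h2
    simp only [Matrix.mulVec, dotProduct, map_sum, map_mul, hF, Matrix.of_apply, hbind]
    refine (mul_eq_zero.1 (Eq.trans ?_ h2)).resolve_left (hχ i')
    rw [Finset.mul_sum]
    exact Finset.sum_congr rfl fun i _ => by ring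
  have hE0 : E = 0 := Matrix.eq_zero_of_mulVec_eq_zero hdet hmv
  rintro ⟨i, j⟩
  have hi : ∑ j, c (i, j) • g j = 0 := by
    have := congrFun hE0 i
    simpa only [hE, Pi.zero_apply] using this
  exact Fintype.linearIndependent_iff.1 hg (fun j => c (i, j)) hi j

/-- STUB (i) of E2 — **outer capacity times invariants.**  If the targets `x z⁻¹` (`x ∈ X ⊆ H₁`,
`z⁻¹ ∈ H₂`) are read `η`-approximately by polynomials of degree `≤ s` with `η·|X||Z| < 1`, and `g` is a
linearly independent family of `b` polynomials of degree `≤ s` that are left-`(H₁,χ₁)`- and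
right-`(H₂,χ₂)`-semi-invariant as functions on `GL_n(ℂ)`, then `|X|·|Z|·b ≤ C(2s+n², n²)`: the products
(reader) × (invariant) are linearly independent in `ℂ[Mat_n]_{≤ 2s}`. [folklore] -/
theorem stub_split_outer_times_invariants_le {n s b : ℕ} {η : ℝ}
    (H₁ H₂ : Subgroup (Matrix.GeneralLinearGroup (Fin n) ℂ)) (χ₁ χ₂ : Matrix.GeneralLinearGroup (Fin n) ℂ → ℂ)
    (X Z : Finset (Matrix.GeneralLinearGroup (Fin n) ℂ))
    (hX : ∀ x ∈ X, x ∈ H₁) (hZ : ∀ z ∈ Z, z⁻¹ ∈ H₂)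
    (hread : ∀ x₀ ∈ X, ∀ z₀ ∈ Z, ∃ r : MvPolynomial (Fin n × Fin n) ℂ, r.totalDegree ≤ s ∧
      ∀ x ∈ X, ∀ z ∈ Z,
        ((x = x₀ ∧ z = z₀) → ‖MvPolynomial.eval (fun ij : Fin n × Fin n =>
          ((x * z⁻¹ : Matrix.GeneralLinearGroup (Fin n) ℂ) : Matrix (Fin n) (Fin n) ℂ) ij.1 ij.2) r - 1‖ ≤ η) ∧
        (¬ (x = x₀ ∧ z = z₀) → ‖MvPolynomial.eval (fun ij : Fin n × Fin n =>
          ((x * z⁻¹ : Matrix.GeneralLinearGroup (Fin n) ℂ) : Matrix (Fin n) (Fin n) ℂ) ij.1 ij.2) r‖ ≤ η))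
    (hη : η * (X.card * Z.card) < 1)
    (g : Fin b → MvPolynomial (Fin n × Fin n) ℂ) (hg : LinearIndependent ℂ g)
    (hgdeg : ∀ j, (g j).totalDegree ≤ s)
    (hgleft : ∀ j, ∀ h ∈ H₁, ∀ w : Matrix.GeneralLinearGroup (Fin n) ℂ,
      MvPolynomial.eval (fun ij : Fin n × Fin n =>
        ((h * w : Matrix.GeneralLinearGroup (Fin n) ℂ) : Matrix (Fin n) (Fin n) ℂ) ij.1 ij.2) (g j) =
      χ₁ h * MvPolynomial.eval (fun ij : Fin n × Fin n => (w : Matrix (Fin n) (Fin n) ℂ) ij.1 ij.2) (g j))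
    (hgright : ∀ j, ∀ h ∈ H₂, ∀ w : Matrix.GeneralLinearGroup (Fin n) ℂ,
      MvPolynomial.eval (fun ij : Fin n × Fin n =>
        ((w * h : Matrix.GeneralLinearGroup (Fin n) ℂ) : Matrix (Fin n) (Fin n) ℂ) ij.1 ij.2) (g j) =
      χ₂ h * MvPolynomial.eval (fun ij : Fin n × Fin n => (w : Matrix (Fin n) (Fin n) ℂ) ij.1 ij.2) (g j)) :
    X.card * Z.card * b ≤ (2 * s + n ^ 2).choose (n ^ 2) := by
  classical
  -- nothing to prove without invariants
  rcases Nat.eq_zero_or_pos b with rfl | hb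
  · simp
  have j₀ : Fin b := ⟨0, hb⟩
  -- a vanishing multiplier on `X` (or on `Z⁻¹`) would kill `g j₀` on all of `GL_n`, hence as a polynomial
  have hχ₁ : ∀ x ∈ X, χ₁ x ≠ 0 := by
    intro x hx h0
    refine hg.ne_zero j₀ (MvPolynomial.eq_of_eval_eq_on_gl fun w => ?_)
    rw [map_zero]
    have h1 := hgleft j₀ x (hX x hx) (x⁻¹ * w)
    rw [mul_inv_cancel_left, h0, zero_mul] at h1
    exact h1
  have hχ₂ : ∀ z ∈ Z, χ₂ z⁻¹ ≠ 0 := by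
    intro z hz h0
    refine hg.ne_zero j₀ (MvPolynomial.eq_of_eval_eq_on_gl fun w => ?_)
    rw [map_zero]
    have h1 := hgright j₀ z⁻¹ (hZ z hz) (w * z)
    rw [mul_inv_cancel_right, h0, zero_mul] at h1
    exact h1
  -- the readers, indexed by `X × Z`
  choose R hRdeg hRsep using fun i : ↥X × ↥Z => hread i.1.1 i.1.2 i.2.1 i.2.2
  -- their value matrix at the points `x z⁻¹` is an `η`-approximate identity, hence nonsingular
  have hcardι : Fintype.card (↥X × ↥Z) = X.card * Z.card := by simp
  have hη' : η * Fintype.card (↥X × ↥Z) < 1 := by rw [hcardι]; push_cast; exact hη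
  have hR : (Matrix.of fun i' i : ↥X × ↥Z => MvPolynomial.eval (fun ij : Fin n × Fin n =>
      ((i'.1.1 * i'.2.1⁻¹ : Matrix.GeneralLinearGroup (Fin n) ℂ) : Matrix (Fin n) (Fin n) ℂ) ij.1 ij.2)
        (R i)).det ≠ 0 := by
    refine splitOuter_det_ne_zero_of_approx_one _ η hη' (fun i => ?_) (fun i' i h => ?_)
    · exact (hRsep i _ i.1.2 _ i.2.2).1 ⟨rfl, rfl⟩
    · exact (hRsep i _ i'.1.2 _ i'.2.2).2 fun h' => h (Prod.ext (Subtype.ext h'.1) (Subtype.ext h'.2))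
  -- two-sided semi-invariance of the `g j` under the points
  have hginv : ∀ j (i' : ↥X × ↥Z) (w : Matrix.GeneralLinearGroup (Fin n) ℂ),
      MvPolynomial.eval (fun ij : Fin n × Fin n =>
        ((i'.1.1 * w * i'.2.1⁻¹ : Matrix.GeneralLinearGroup (Fin n) ℂ) : Matrix (Fin n) (Fin n) ℂ) ij.1 ij.2)
          (g j) =
      (χ₁ i'.1.1 * χ₂ i'.2.1⁻¹) *
        MvPolynomial.eval (fun ij : Fin n × Fin n => (w : Matrix (Fin n) (Fin n) ℂ) ij.1 ij.2) (g j) := by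
    intro j i' w
    rw [mul_assoc i'.1.1 w, hgleft j _ (hX _ i'.1.2) (w * i'.2.1⁻¹), hgright j _ (hZ _ i'.2.2) w]
    ring
  -- so the products (reader) × (invariant) are linearly independent ...
  have hind := splitOuter_linearIndependent_mul (fun i : ↥X × ↥Z => i.1.1) (fun i => i.2.1)
    (fun i => χ₁ i.1.1 * χ₂ i.2.1⁻¹) (fun i => mul_ne_zero (hχ₁ _ i.1.2) (hχ₂ _ i.2.2)) R hR g hg hginv
  -- ... and of degree `≤ 2s`
  have hmem : ∀ k : (↥X × ↥Z) × Fin b,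
      R k.1 * g k.2 ∈ MvPolynomial.restrictTotalDegree (Fin n × Fin n) ℂ (2 * s) := by
    intro k
    rw [MvPolynomial.mem_restrictTotalDegree]
    refine (MvPolynomial.totalDegree_mul _ _).trans ?_
    have h1 := hRdeg k.1
    have h2 := hgdeg k.2
    omega
  have hP : LinearIndependent ℂ fun k : (↥X × ↥Z) × Fin b =>
      (⟨R k.1 * g k.2, hmem k⟩ : MvPolynomial.restrictTotalDegree (Fin n × Fin n) ℂ (2 * s)) :=
    LinearIndependent.of_comp (Submodule.subtype _) hind
  have hcard := hP.fintype_card_le_finrank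
  rw [stub_finrank_restrictTotalDegree] at hcard
  have h1 : Fintype.card ((↥X × ↥Z) × Fin b) = X.card * Z.card * b := by simp
  have h2 : Fintype.card (Fin n × Fin n) = n ^ 2 := by simp [sq]
  rw [h1, h2] at hcard
  exact hcard

end Summit.MatrixMultiplication.MatrixMultiplication.Theorems.BorderHalfDimensionDesigns
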